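import Mathlib
import Literature.AlgebraicTopology.SingularHomology.LoopClassesSpan
import Literature.AlgebraicTopology.SingularHomology.HurewiczOne
import HarnessLib

/-!
# `H₁` of a space whose fundamental group is cyclic is spanned by one Hurewicz class; the image of
# `H₁` of such a piece; quotient bookkeeping for iterated Mayer–Vietoris steps
(helper for stub `stub_isLefschetzHandlebody_homology` = NF5
`Literature.Topology.FourManifolds.LefschetzBase.isLefschetzHandlebody_homology`, line
`modp-braid-orbits` r9, crux `ConvexBisection.AcyclicBisectionExists`, item stmt-SmoothPoincare4-10508;
wave 2 / W2-2: the homology ENGINE of Kosinski multi-attachments of 2-handles, Hurewicz half)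

In the Mayer–Vietoris computation of `H₁(V ∪ H² ∪ ⋯ ∪ H²)` (Gompf–Stipsicz 1999, §4.4:
`H₁(X ∪ 2-handles) = H₁(X)/⟨attaching circles⟩`) the overlap of the base piece with the `i`-th handle
piece is the punctured tube `T ∖ S ≃ S¹ × (open 3-cell)`, whose fundamental group is infinite cyclic on a
parallel copy of the attaching circle (`TwoHandleTubeDeformation*.lean`, `TwoHandleAttachmentPi1.lean`:
strong deformation retraction onto the parallel circle, `zpowers_liftPath_eq_top_of_simpleClosed`).  The
passage from `π₁` to `H₁` is Hurewicz in degree one (Hatcher 2002, Thm. 2A.1; tree: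
`HurewiczOne.lean`, `LoopClassesSpan.lean`):

* `span_loopClass_eq_top_of_zpow` — **if every loop at `x₀` is homotopic to a power of the loop `L`
  (in `π₁(X, x₀)`), then `H₁(X; R) = R ∙ h(L)`** (loop classes span `H₁`, and `h` is a homomorphism);
* `range_map_one_eq_span` — hence **the image of `f_* : H₁(X; R) → H₁(Y; R)` is `R ∙ h(f ∘ L)`**
  (naturality of `h`): the image of `H₁(A ∩ Bᵢ)` in `H₁(A)` is the span of the attaching class;
* `ker_comp_eq_sup`, `nonempty_equiv_quot_of_surjective`, `nonempty_equiv_quot_congr` — composing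
  the one-handle steps `H₁(X_s) ↠ H₁(X_s ∪ Bᵢ)` (kernel = image of the span pushed forward) into
  **`H₁(X) ≅ H₁(A) ⧸ ⨆ᵢ R ∙ (attaching class i)`**;
* §3 the registered sub-goal stub `stub_multiAttachment_loopSpan`.

Everything is proved; no named facts, no `sorry`, no definitions.  References: A. Hatcher,
*Algebraic Topology* (2002), Thm. 2A.1, §2.2 p. 149 [HatcherAT2002]; R. E. Gompf, A. I. Stipsicz,
*4-Manifolds and Kirby Calculus* (1999), §4.4 [GompfStipsicz1999].
-/

noncomputable section

-- the prescribed namespace `Summit.<P>.<Sub>.…` duplicates `SmoothPoincare4` (P = Sub)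
set_option linter.dupNamespace false

open Set Function CategoryTheory CategoryTheory.Limits
open Literature.AlgebraicTopology.SingularHomology

namespace Summit.SmoothPoincare4.SmoothPoincare4.Theorems.AcyclicBisectionExists.ModpBraidOrbits

universe u v w

/-! ## §1 Hurewicz: `H₁` of a space with cyclic `π₁` -/

section Hurewicz

variable (R : Type v) [CommRing R] {X Y : Type u} [TopologicalSpace X] [TopologicalSpace Y]

/-- **If every loop at `x₀` is a power of `L` in `π₁(X, x₀)` then `H₁(X; R)` is spanned by the
Hurewicz class of `L`** (loop classes span `H₁` of a path-connected space, Hatcher Thm. 2A.1, and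
`h(γ) = h(Lⁿ) = n • h(L)`). [cite: HatcherAT2002, Thm. 2A.1] -/
theorem span_loopClass_eq_top_of_zpow [PathConnectedSpace X] {x₀ : X} (L : Path x₀ x₀)
    (hL : ∀ γ : Path x₀ x₀, ∃ n : ℤ, FundamentalGroup.fromPath (Path.Homotopic.Quotient.mk γ) =
      FundamentalGroup.fromPath (Path.Homotopic.Quotient.mk L) ^ n) :
    Submodule.span R {loopClass R R (1 : R) L} = ⊤ := by
  rw [eq_top_iff, ← HurewiczProof.span_loopClass_eq_top x₀, Submodule.span_le]
  rintro _ ⟨γ, rfl⟩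
  obtain ⟨n, hn⟩ := hL γ
  have h := congrArg (fun g => Multiplicative.toAdd (hurewiczOne R R (1 : R) x₀ g)) hn
  simp only [map_zpow, hurewiczOne_fromPath, toAdd_ofAdd, toAdd_zpow] at h
  show loopClass R R (1 : R) γ ∈ Submodule.span R {loopClass R R (1 : R) L}
  rw [h]
  exact zsmul_mem (Submodule.subset_span (mem_singleton _)) n

/-- **The image of `f_* : H₁(X; R) → H₁(Y; R)` is the span of `h(f ∘ L)`** when every loop at
`x₀` is a power of `L` in `π₁(X, x₀)` (naturality of the Hurewicz class, `map_loopClass`).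
[cite: HatcherAT2002, Thm. 2A.1] -/
theorem range_map_one_eq_span [PathConnectedSpace X] {x₀ : X} (L : Path x₀ x₀)
    (hL : ∀ γ : Path x₀ x₀, ∃ n : ℤ, FundamentalGroup.fromPath (Path.Homotopic.Quotient.mk γ) =
      FundamentalGroup.fromPath (Path.Homotopic.Quotient.mk L) ^ n) (f : C(X, Y)) :
    LinearMap.range (singularHomology.map R R f 1).hom =
      Submodule.span R {loopClass R R (1 : R) (L.map f.continuous)} := by
  rw [LinearMap.range_eq_map, ← span_loopClass_eq_top_of_zpow R L hL, Submodule.map_span,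
    image_singleton]
  congr 2
  exact map_loopClass R R (1 : R) L f

/-- The span of the Hurewicz class is carried to the span of the Hurewicz class of the image loop
by any induced map (no hypothesis on `π₁`). [cite: HatcherAT2002, Thm. 2A.1] -/
theorem map_span_loopClass {x₀ : X} (L : Path x₀ x₀) (f : C(X, Y)) :
    Submodule.map (singularHomology.map R R f 1).hom (Submodule.span R {loopClass R R (1 : R) L}) =
      Submodule.span R {loopClass R R (1 : R) (L.map f.continuous)} := by
  rw [Submodule.map_span, image_singleton]
  congr 2
  exact map_loopClass R R (1 : R) L f

/-- Freely homotopic loops (through a homotopy of based loops after reparametrisation are not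
needed): **loops that agree as maps have the same Hurewicz class**, the form in which a parallel
circle pushed into the manifold is compared with the attaching circle after a deformation.
[folklore] -/
theorem loopClass_eq_of_coe_eq {x y : X} (γ : Path x x) (γ' : Path y y)
    (h : (γ : unitInterval → X) = γ') : loopClass R R (1 : R) γ = loopClass R R (1 : R) γ' := by
  apply loopClass_eq_of_ofPath_eq
  obtain rfl : x = y := by
    have := congrFun h 0
    simpa using this
  have : γ = γ' := Path.ext h
  rw [this]

end Hurewicz

/-! ## §2 Quotient bookkeeping for iterated one-handle steps -/

section Algebra

variable {R : Type v} [CommRing R] {P Q T : Type*} [AddCommGroup P] [Module R P]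
  [AddCommGroup Q] [Module R Q] [AddCommGroup T] [Module R T]

/-- **Composing two steps.**  If `F : P → Q` has kernel `N` and `G : Q → T` has kernel the image
`F(N')` of a submodule `N' ≤ P`, then `G ∘ F` has kernel `N' ⊔ N`. [folklore] -/
theorem ker_comp_eq_sup {F : P →ₗ[R] Q} {G : Q →ₗ[R] T} {N N' : Submodule R P}
    (hF : LinearMap.ker F = N) (hG : LinearMap.ker G = Submodule.map F N') :
    LinearMap.ker (G ∘ₗ F) = N' ⊔ N := by
  rw [LinearMap.ker_comp, hG, Submodule.comap_map_eq, hF]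

/-- The image under `F` of the image of `G'` is the image of `F ∘ G'`. [folklore] -/
theorem map_range_eq_range_comp {S : Type*} [AddCommGroup S] [Module R S] (F : P →ₗ[R] Q)
    (G' : S →ₗ[R] P) : Submodule.map F (LinearMap.range G') = LinearMap.range (F ∘ₗ G') :=
  (LinearMap.range_comp G' F).symm

/-- **A surjection with known kernel is a quotient map**: `Q ≃ P ⧸ N` (the form `Nonempty (_ ≃ₗ _)`
of NF5's clause 2). [folklore] -/
theorem nonempty_equiv_quot_of_surjective {F : P →ₗ[R] Q} {N : Submodule R P}
    (hs : Function.Surjective F) (hk : LinearMap.ker F = N) : Nonempty (Q ≃ₗ[R] P ⧸ N) :=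
  ⟨(F.quotKerEquivOfSurjective hs).symm.trans (Submodule.quotEquivOfEq _ _ hk)⟩

/-- Transport of a quotient description along linear isomorphisms of source and target: if
`Q ≃ P ⧸ N`, `P ≃ P'` carrying `N` to `N'`, and `Q ≃ Q'`, then `Q' ≃ P' ⧸ N'`. [folklore] -/
theorem nonempty_equiv_quot_congr {P' Q' : Type*} [AddCommGroup P'] [Module R P'] [AddCommGroup Q']
    [Module R Q'] {N : Submodule R P} {N' : Submodule R P'} (h : Nonempty (Q ≃ₗ[R] P ⧸ N))
    (eP : P ≃ₗ[R] P') (eQ : Q ≃ₗ[R] Q') (hN : Submodule.map (eP : P →ₗ[R] P') N = N') :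
    Nonempty (Q' ≃ₗ[R] P' ⧸ N') :=
  ⟨(eQ.symm.trans h.some).trans (Submodule.Quotient.equiv N N' eP hN)⟩

end Algebra

/-! ## §3 The registered sub-goal stub -/

/-- **Hurewicz half of the multi-attachment engine** (registered sub-goal stub
`stub_multiAttachment_loopSpan` of `stub_isLefschetzHandlebody_homology`): if every loop at `x₀`
of a path-connected `X` is a power of `L` in `π₁(X, x₀)`, then for every continuous `f : X → Y`
the image of `f_* : H₁(X; R) → H₁(Y; R)` is the `R`-span of the Hurewicz class of `f ∘ L` —
applied to the punctured tube `X = A ∩ Bᵢ ≃ T ∖ S` (cyclic `π₁` on a parallel of the attaching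
circle) and the inclusion into the base piece `A`, the image of `H₁(A ∩ Bᵢ)` in `H₁(A)` is the span
of the attaching class. [cite: HatcherAT2002, Thm. 2A.1] -/
theorem stub_multiAttachment_loopSpan : ∀ (R : Type) [CommRing R] (X Y : Type)
    [TopologicalSpace X] [TopologicalSpace Y] [PathConnectedSpace X] (x₀ : X) (L : Path x₀ x₀)
    (f : C(X, Y)), (∀ γ : Path x₀ x₀, ∃ n : ℤ,
      FundamentalGroup.fromPath (Path.Homotopic.Quotient.mk γ) =
        FundamentalGroup.fromPath (Path.Homotopic.Quotient.mk L) ^ n) →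
    LinearMap.range (Literature.AlgebraicTopology.SingularHomology.singularHomology.map R R f 1).hom
      = Submodule.span R {Literature.AlgebraicTopology.SingularHomology.loopClass R R (1 : R)
          (L.map f.continuous)} :=
  fun R _ _ _ _ _ _ _ L f hL => range_map_one_eq_span R L hL f

end Summit.SmoothPoincare4.SmoothPoincare4.Theorems.AcyclicBisectionExists.ModpBraidOrbits
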